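import Literature.Topology.FourManifolds.CappellShanesonIwakiWindow
import Literature.Topology.FourManifolds.CappellShanesonClassGroupSeventyGompf
import Literature.Topology.FourManifolds.CappellShanesonClassGroupSeventythreeGompf
import Literature.Topology.FourManifolds.CappellShanesonClassGroupSeventyfiveGompf
import Literature.Topology.FourManifolds.CappellShanesonClassGroupSeventysevenGompf
import HarnessLib

/-!
# Gompf's conjecture for the traces `-73 ≤ n ≤ 78`, `n ≠ 76, -71`, REDUCED to ten standard matrices

K. Iwaki, *Infinite families of standard Cappell–Shaneson homotopy 4-spheres*, Topology Appl. 366 (2025)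
109293 = arXiv:2404.05096, Thm. 5.1, proves Gompf's conjecture — in the tree's matrix form
`GompfConjectureForTrace n`: every `A ∈ SL(3, ℤ)` with `det (A - 1) = 1` and `tr A = n` is Gompf equivalent to the
Akbulut–Kirby matrix `A₀` — for `-64 ≤ n ≤ 69` and `n = -73, -69, -67, -66, 71, 72, 74, 78` (tree:
`CappellShanesonIwakiWindow.lean`), from the Table of representatives of `C(ℤ[θₙ])`, `70 ≤ n ≤ 78` (§4.3, MAGMA) and
the procedure of §5.1 (Lemma 5.2 = Kim–Yamada's Lemma 6.1, plus printed chains for some special classes).  The rows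
`n = 70, 73, 75, 77` of that Table are certified in the tree as well (`…ClassGroupSeventy*.lean`,
`…ClassGroupSeventythree*.lean`, `…ClassGroupSeventyfive*.lean`, `…ClassGroupSeventyseven*.lean`), where the
procedure leaves special classes undecided — §5.1: "if it is uncertain whether or not a special `(c,d,n)` is
equivalent to `(1,1,2)`, such `(c,d,n)` are double underlined" — namely (tree: the `…Gompf.lean` parts)
`(104, 141, 70)`, `(37, 155, 70)`; `(178, 191, 73)`, `(23, 145, 73)`, `(41, 189, 73)`, `(23, 171, 73)`;
`(101, 163, 75)`, `(31, 197, 75)`; `(61, 253, 77)`, `(92, 149, 77)`, `(34, 145, 77)`, the last of which moves to the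
trace `-68 = 5 - 73` (`gompfConjectureForTrace_seventyseven_of_seventythree_undecided`).  The row `n = 76` is not
treated here (`ℤ[θ₇₆]` is not the maximal order: `Δ(f₇₆) = 7³ · 17 · 4999`), hence neither is its mirror `-71 = 5 - 76`
(Kim–Yamada's Theorem A).

This file only COLLECTS these results: Gompf's conjecture for every trace `n` with `-73 ≤ n ≤ 78`, `n ≠ 76`,
`n ≠ -71` follows from — and, trivially, implies — the Gompf equivalence with `A₀` of the TEN standard matrices
`X_{104,141,70}`, `X_{37,155,70}`, `X_{178,191,73}`, `X_{23,145,73}`, `X_{41,189,73}`, `X_{23,171,73}`, `X_{101,163,75}`,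
`X_{31,197,75}`, `X_{61,253,77}`, `X_{92,149,77}` (`gompfConjectureForTrace_of_mem_Icc_neg_seventythree_seventyeight_iff`);
the sub-window `[-70, 75]` needs only the first eight (`gompfConjectureForTrace_of_mem_Icc_neg_seventy_seventyfive_iff`).
Nothing here decides any of these classes; no named fact is introduced (D-0026).

## References
* [Iwaki2025] K. Iwaki, Topology Appl. 366 (2025) 109293 (arXiv:2404.05096): Thm. 5.1, Lemma 5.2, §4.3 (Table of
  representatives, `70 ≤ n ≤ 78`), §5.1 (special classes and chains).
* [KimYamada2023] M. H. Kim, S. Yamada, Kyungpook Math. J. 63 (2023) 373–411: Thm. A (`n ↦ 5 - n`), Thm. B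
  (`-64 ≤ n ≤ 69`), Lemma 6.1.
-/

noncomputable section

open Set Polynomial

namespace Literature.Topology.FourManifolds

/-- **Gompf's conjecture on the window `[-70, 75]` from the eight undecided classes of the rows `70`, `73`, `75`**
(Kim–Yamada's window `[-64, 69]`, Iwaki's traces `71, 72, 74` and `-66, -67, -69`, and the certified reductions at
`70 ∕ -65`, `73 ∕ -68`, `75 ∕ -70`). [cite: Iwaki2025, Thm. 5.1, §4.3 and §5.1] [cite: KimYamada2023, Thm. A and Thm. B] -/
theorem gompfConjectureForTrace_of_mem_Icc_neg_seventy_seventyfive_of_undecided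
    (h70₁ : ∀ h : (141 : ℤ) ∣ (csPoly 70).eval 104, GompfEquiv (standardCSMatrix 104 141 70 h) akbulutKirbyMatrix)
    (h70₂ : ∀ h : (155 : ℤ) ∣ (csPoly 70).eval 37, GompfEquiv (standardCSMatrix 37 155 70 h) akbulutKirbyMatrix)
    (h73₁ : ∀ h : (191 : ℤ) ∣ (csPoly 73).eval 178, GompfEquiv (standardCSMatrix 178 191 73 h) akbulutKirbyMatrix)
    (h73₂ : ∀ h : (145 : ℤ) ∣ (csPoly 73).eval 23, GompfEquiv (standardCSMatrix 23 145 73 h) akbulutKirbyMatrix)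
    (h73₃ : ∀ h : (189 : ℤ) ∣ (csPoly 73).eval 41, GompfEquiv (standardCSMatrix 41 189 73 h) akbulutKirbyMatrix)
    (h73₄ : ∀ h : (171 : ℤ) ∣ (csPoly 73).eval 23, GompfEquiv (standardCSMatrix 23 171 73 h) akbulutKirbyMatrix)
    (h75₁ : ∀ h : (163 : ℤ) ∣ (csPoly 75).eval 101, GompfEquiv (standardCSMatrix 101 163 75 h) akbulutKirbyMatrix)
    (h75₂ : ∀ h : (197 : ℤ) ∣ (csPoly 75).eval 31, GompfEquiv (standardCSMatrix 31 197 75 h) akbulutKirbyMatrix)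
    {n : ℤ} (hn : n ∈ Icc (-70 : ℤ) 75) : GompfConjectureForTrace n := by
  simp only [mem_Icc] at hn
  obtain ⟨h1, h2⟩ := hn
  by_cases hw : -64 ≤ n ∧ n ≤ 69
  · exact gompfConjectureForTrace_of_mem_Icc_neg_sixtyfour_sixtynine (mem_Icc.mpr hw)
  · have h : n = 70 ∨ n = 71 ∨ n = 72 ∨ n = 73 ∨ n = 74 ∨ n = 75 ∨ n = -65 ∨ n = -66 ∨ n = -67 ∨ n = -68 ∨
        n = -69 ∨ n = -70 := by omega
    rcases h with rfl | rfl | rfl | rfl | rfl | rfl | rfl | rfl | rfl | rfl | rfl | rfl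
    · exact gompfConjectureForTrace_seventy_of_undecided h70₁ h70₂
    · exact gompfConjectureForTrace_seventyone
    · exact gompfConjectureForTrace_seventytwo
    · exact gompfConjectureForTrace_seventythree_of_undecided h73₁ h73₂ h73₃ h73₄
    · exact gompfConjectureForTrace_seventyfour
    · exact gompfConjectureForTrace_seventyfive_of_undecided h75₁ h75₂
    · exact gompfConjectureForTrace_neg_sixtyfive_of_undecided h70₁ h70₂
    · exact gompfConjectureForTrace_neg_sixtysix
    · exact gompfConjectureForTrace_neg_sixtyseven
    · exact gompfConjectureForTrace_neg_sixtyeight_of_undecided h73₁ h73₂ h73₃ h73₄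
    · exact gompfConjectureForTrace_neg_sixtynine
    · exact gompfConjectureForTrace_neg_seventy_of_undecided h75₁ h75₂

/-- **Gompf's conjecture holds for every trace `-70 ≤ n ≤ 75` if and only if the eight undecided standard matrices of
the rows `70`, `73`, `75` are Gompf equivalent to `A₀`** (⇒: the conjecture at `70`, `73`, `75` applied to these
matrices). [cite: Iwaki2025, Thm. 5.1, §4.3 and §5.1] [cite: KimYamada2023, Thm. A and Thm. B] -/
theorem gompfConjectureForTrace_of_mem_Icc_neg_seventy_seventyfive_iff :
    (∀ n ∈ Icc (-70 : ℤ) 75, GompfConjectureForTrace n) ↔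
      (∀ h : (141 : ℤ) ∣ (csPoly 70).eval 104, GompfEquiv (standardCSMatrix 104 141 70 h) akbulutKirbyMatrix) ∧
        (∀ h : (155 : ℤ) ∣ (csPoly 70).eval 37, GompfEquiv (standardCSMatrix 37 155 70 h) akbulutKirbyMatrix) ∧
        (∀ h : (191 : ℤ) ∣ (csPoly 73).eval 178, GompfEquiv (standardCSMatrix 178 191 73 h) akbulutKirbyMatrix) ∧
        (∀ h : (145 : ℤ) ∣ (csPoly 73).eval 23, GompfEquiv (standardCSMatrix 23 145 73 h) akbulutKirbyMatrix) ∧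
        (∀ h : (189 : ℤ) ∣ (csPoly 73).eval 41, GompfEquiv (standardCSMatrix 41 189 73 h) akbulutKirbyMatrix) ∧
        (∀ h : (171 : ℤ) ∣ (csPoly 73).eval 23, GompfEquiv (standardCSMatrix 23 171 73 h) akbulutKirbyMatrix) ∧
        (∀ h : (163 : ℤ) ∣ (csPoly 75).eval 101, GompfEquiv (standardCSMatrix 101 163 75 h) akbulutKirbyMatrix) ∧
        ∀ h : (197 : ℤ) ∣ (csPoly 75).eval 31, GompfEquiv (standardCSMatrix 31 197 75 h) akbulutKirbyMatrix := by
  constructor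
  · intro hG
    have h70 : GompfConjectureForTrace 70 := hG 70 (by norm_num)
    have h73 : GompfConjectureForTrace 73 := hG 73 (by norm_num)
    have h75 : GompfConjectureForTrace 75 := hG 75 (by norm_num)
    exact ⟨fun h => h70.standardCSMatrix h, fun h => h70.standardCSMatrix h, fun h => h73.standardCSMatrix h,
      fun h => h73.standardCSMatrix h, fun h => h73.standardCSMatrix h, fun h => h73.standardCSMatrix h,
      fun h => h75.standardCSMatrix h, fun h => h75.standardCSMatrix h⟩
  · rintro ⟨h70₁, h70₂, h73₁, h73₂, h73₃, h73₄, h75₁, h75₂⟩ n hn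
    exact gompfConjectureForTrace_of_mem_Icc_neg_seventy_seventyfive_of_undecided h70₁ h70₂ h73₁ h73₂ h73₃ h73₄
      h75₁ h75₂ hn

/-- **Gompf's conjecture for `-73 ≤ n ≤ 78`, `n ≠ 76`, `n ≠ -71`, from ten undecided classes** (the eight of the rows
`70`, `73`, `75`, and `(61, 253, 77)`, `(92, 149, 77)` of the row `77` — its third special class `(34, 145, 77)` moves to
the trace `-68`; Iwaki's traces `78`, `-73` and Kim–Yamada's Theorem A for `-72 = 5 - 77`).
[cite: Iwaki2025, Thm. 5.1, Lemma 5.2, §4.3 and §5.1] [cite: KimYamada2023, Thm. A and Thm. B] -/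
theorem gompfConjectureForTrace_of_mem_Icc_neg_seventythree_seventyeight_of_undecided
    (h70₁ : ∀ h : (141 : ℤ) ∣ (csPoly 70).eval 104, GompfEquiv (standardCSMatrix 104 141 70 h) akbulutKirbyMatrix)
    (h70₂ : ∀ h : (155 : ℤ) ∣ (csPoly 70).eval 37, GompfEquiv (standardCSMatrix 37 155 70 h) akbulutKirbyMatrix)
    (h73₁ : ∀ h : (191 : ℤ) ∣ (csPoly 73).eval 178, GompfEquiv (standardCSMatrix 178 191 73 h) akbulutKirbyMatrix)
    (h73₂ : ∀ h : (145 : ℤ) ∣ (csPoly 73).eval 23, GompfEquiv (standardCSMatrix 23 145 73 h) akbulutKirbyMatrix)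
    (h73₃ : ∀ h : (189 : ℤ) ∣ (csPoly 73).eval 41, GompfEquiv (standardCSMatrix 41 189 73 h) akbulutKirbyMatrix)
    (h73₄ : ∀ h : (171 : ℤ) ∣ (csPoly 73).eval 23, GompfEquiv (standardCSMatrix 23 171 73 h) akbulutKirbyMatrix)
    (h75₁ : ∀ h : (163 : ℤ) ∣ (csPoly 75).eval 101, GompfEquiv (standardCSMatrix 101 163 75 h) akbulutKirbyMatrix)
    (h75₂ : ∀ h : (197 : ℤ) ∣ (csPoly 75).eval 31, GompfEquiv (standardCSMatrix 31 197 75 h) akbulutKirbyMatrix)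
    (h77₁ : ∀ h : (253 : ℤ) ∣ (csPoly 77).eval 61, GompfEquiv (standardCSMatrix 61 253 77 h) akbulutKirbyMatrix)
    (h77₂ : ∀ h : (149 : ℤ) ∣ (csPoly 77).eval 92, GompfEquiv (standardCSMatrix 92 149 77 h) akbulutKirbyMatrix)
    {n : ℤ} (hn : n ∈ Icc (-73 : ℤ) 78) (h76 : n ≠ 76) (h71 : n ≠ -71) : GompfConjectureForTrace n := by
  simp only [mem_Icc] at hn
  obtain ⟨h1, h2⟩ := hn
  by_cases hw : -70 ≤ n ∧ n ≤ 75
  · exact gompfConjectureForTrace_of_mem_Icc_neg_seventy_seventyfive_of_undecided h70₁ h70₂ h73₁ h73₂ h73₃ h73₄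
      h75₁ h75₂ (mem_Icc.mpr hw)
  · have h : n = 77 ∨ n = 78 ∨ n = -72 ∨ n = -73 := by omega
    rcases h with rfl | rfl | rfl | rfl
    · exact gompfConjectureForTrace_seventyseven_of_seventythree_undecided h73₁ h73₂ h73₃ h73₄ h77₁ h77₂
    · exact gompfConjectureForTrace_seventyeight
    · have h77 := gompfConjectureForTrace_of_five_sub
        (gompfConjectureForTrace_seventyseven_of_seventythree_undecided h73₁ h73₂ h73₃ h73₄ h77₁ h77₂)
      norm_num at h77
      exact h77
    · exact gompfConjectureForTrace_neg_seventythree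

/-- **Gompf's conjecture holds for every trace `-73 ≤ n ≤ 78` other than `76` and `-71` if and only if ten explicit
standard Cappell–Shaneson matrices are Gompf equivalent to `A₀`**: `X_{104,141,70}`, `X_{37,155,70}`, `X_{178,191,73}`,
`X_{23,145,73}`, `X_{41,189,73}`, `X_{23,171,73}`, `X_{101,163,75}`, `X_{31,197,75}`, `X_{61,253,77}`, `X_{92,149,77}` — the
undecided special classes of Iwaki's Table (§4.3, §5.1) for the rows certified in the tree, less `(34, 145, 77)`, which
moves to the trace `-68`. [cite: Iwaki2025, Thm. 5.1, Lemma 5.2, §4.3 and §5.1] [cite: KimYamada2023, Thm. A and Thm. B] -/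
theorem gompfConjectureForTrace_of_mem_Icc_neg_seventythree_seventyeight_iff :
    (∀ n ∈ Icc (-73 : ℤ) 78, n ≠ 76 → n ≠ -71 → GompfConjectureForTrace n) ↔
      (∀ h : (141 : ℤ) ∣ (csPoly 70).eval 104, GompfEquiv (standardCSMatrix 104 141 70 h) akbulutKirbyMatrix) ∧
        (∀ h : (155 : ℤ) ∣ (csPoly 70).eval 37, GompfEquiv (standardCSMatrix 37 155 70 h) akbulutKirbyMatrix) ∧
        (∀ h : (191 : ℤ) ∣ (csPoly 73).eval 178, GompfEquiv (standardCSMatrix 178 191 73 h) akbulutKirbyMatrix) ∧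
        (∀ h : (145 : ℤ) ∣ (csPoly 73).eval 23, GompfEquiv (standardCSMatrix 23 145 73 h) akbulutKirbyMatrix) ∧
        (∀ h : (189 : ℤ) ∣ (csPoly 73).eval 41, GompfEquiv (standardCSMatrix 41 189 73 h) akbulutKirbyMatrix) ∧
        (∀ h : (171 : ℤ) ∣ (csPoly 73).eval 23, GompfEquiv (standardCSMatrix 23 171 73 h) akbulutKirbyMatrix) ∧
        (∀ h : (163 : ℤ) ∣ (csPoly 75).eval 101, GompfEquiv (standardCSMatrix 101 163 75 h) akbulutKirbyMatrix) ∧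
        (∀ h : (197 : ℤ) ∣ (csPoly 75).eval 31, GompfEquiv (standardCSMatrix 31 197 75 h) akbulutKirbyMatrix) ∧
        (∀ h : (253 : ℤ) ∣ (csPoly 77).eval 61, GompfEquiv (standardCSMatrix 61 253 77 h) akbulutKirbyMatrix) ∧
        ∀ h : (149 : ℤ) ∣ (csPoly 77).eval 92, GompfEquiv (standardCSMatrix 92 149 77 h) akbulutKirbyMatrix := by
  constructor
  · intro hG
    have h70 : GompfConjectureForTrace 70 := hG 70 (by norm_num) (by norm_num) (by norm_num)
    have h73 : GompfConjectureForTrace 73 := hG 73 (by norm_num) (by norm_num) (by norm_num)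
    have h75 : GompfConjectureForTrace 75 := hG 75 (by norm_num) (by norm_num) (by norm_num)
    have h77 : GompfConjectureForTrace 77 := hG 77 (by norm_num) (by norm_num) (by norm_num)
    exact ⟨fun h => h70.standardCSMatrix h, fun h => h70.standardCSMatrix h, fun h => h73.standardCSMatrix h,
      fun h => h73.standardCSMatrix h, fun h => h73.standardCSMatrix h, fun h => h73.standardCSMatrix h,
      fun h => h75.standardCSMatrix h, fun h => h75.standardCSMatrix h, fun h => h77.standardCSMatrix h,
      fun h => h77.standardCSMatrix h⟩
  · rintro ⟨h70₁, h70₂, h73₁, h73₂, h73₃, h73₄, h75₁, h75₂, h77₁, h77₂⟩ n hn h76 h71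
    exact gompfConjectureForTrace_of_mem_Icc_neg_seventythree_seventyeight_of_undecided h70₁ h70₂ h73₁ h73₂ h73₃
      h73₄ h75₁ h75₂ h77₁ h77₂ hn h76 h71

/-- **The special class `(34, 145, 77)` is covered by the ten**: its standard matrix is Gompf equivalent to `A₀` as
soon as the four undecided classes of the row `73` are (one Gompf move to the trace `-68 = 5 - 73`).
[cite: Iwaki2025, Lemma 5.2 and §4.3 (Table, rows 73 and 77)] [cite: KimYamada2023, Thm. A] -/
theorem gompfEquiv_standardCSMatrix_34_145_77_of_seventythree_undecided
    (h73₁ : ∀ h : (191 : ℤ) ∣ (csPoly 73).eval 178, GompfEquiv (standardCSMatrix 178 191 73 h) akbulutKirbyMatrix)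
    (h73₂ : ∀ h : (145 : ℤ) ∣ (csPoly 73).eval 23, GompfEquiv (standardCSMatrix 23 145 73 h) akbulutKirbyMatrix)
    (h73₃ : ∀ h : (189 : ℤ) ∣ (csPoly 73).eval 41, GompfEquiv (standardCSMatrix 41 189 73 h) akbulutKirbyMatrix)
    (h73₄ : ∀ h : (171 : ℤ) ∣ (csPoly 73).eval 23, GompfEquiv (standardCSMatrix 23 171 73 h) akbulutKirbyMatrix)
    (h : (145 : ℤ) ∣ (csPoly 77).eval 34) : GompfEquiv (standardCSMatrix 34 145 77 h) akbulutKirbyMatrix :=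
  gompfEquiv_standardCSMatrix_34_145_77_of_neg_sixtyeight
    (gompfConjectureForTrace_neg_sixtyeight_of_undecided h73₁ h73₂ h73₃ h73₄) h

end Literature.Topology.FourManifolds

end
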